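import Literature.AlgebraicGeometry.Modules.CechResolution
import Literature.AlgebraicGeometry.Modules.FrameMatrixEnd
import Literature.AlgebraicGeometry.Modules.UnitCocycle
import HarnessLib

/-!
# Čech cochains of `𝓔nd(E)` in local frames: from matrix cochains to morphisms `E → Čⁿ(𝓤, E)`

Let `E` be an `𝒪_X`-module on a scheme `X` with a **framing** `𝔣 = (U_a, I_a, e_a)_{a ∈ ι}`
(`Framing`): opens `U_a` and frames `e_a : 𝒪^{I_a} ≅ E|_{U_a}`, with transition matrices
`T_{ab} = T(e_a, e_b)` (`Framing.T`). A **matrix `n`-cochain** (`Framing.Cochain n`) assigns to every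
simplex `α = (α₀, …, αₙ)` and every open `V` below all `U_{α_k}` a matrix
`X_α ∈ M_{I_{α₀} × I_{αₙ}}(Γ(X, V))`, compatibly with restriction — the shape in which Čech cochains
of `𝓔nd(E)` arise from transition data ("from the frame at the last vertex to the frame at the
first"; e.g. the defect `T̃_{ab} T̃_{bd} - T̃_{ad}` of lifted transition matrices). Such a matrix
acts as the local endomorphism

  `𝔣.op a z V A = matrixEnd e_a (A · T_{za}) : E|_V → E|_V`

(`Modules/FrameMatrixEnd.lean`), and the cochain `X` defines the morphism of `𝒪_X`-modules

  `𝔣.toEnd n X : E ⟶ Čⁿ(𝓤, E)`,  `s ↦ (op_{α₀ αₙ}(X_α)(s|_{V ∩ U_α}))_α`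

into the Čech sheaf of `Modules/CechObjects.lean` — i.e. the Čech `n`-cochain of `𝓔nd(E)` written
in the frames, as a morphism into the Čech resolution of `E` (the form consumed by the iterated
connecting classes `θ` of `Literature/Algebra/Homology/IteratedExtClass.lean`). Proved here:
restriction and frame-change rules for `op` (`restrictHom_op`, `op_eq_op_of_frame`,
`op_eq_op_of_target`), its additivity and injectivity, the components of `toEnd` (`toEnd_app`) and
their restrictions (`res_appLE_op`). The Čech differential of `toEnd n X` in matrix form is in
`Modules/CechEndCochainDifferential.lean`. Everything is proved; no named facts.

## References

* R. Hartshorne, *Algebraic Geometry*, GTM 52 (1977), III.4 (Čech cohomology), II.5.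
  [Hartshorne1977]
* R. Godement, *Topologie algébrique et théorie des faisceaux* (1958), II.5.
-/

noncomputable section

open CategoryTheory AlgebraicGeometry Opposite TopologicalSpace Limits

namespace Literature.AlgebraicGeometry.Modules

open Literature.AlgebraicGeometry.Motives

universe u

variable {X : Scheme.{u}} (E : X.Modules) (ι : Type u)

/-- **A framing of an `𝒪_X`-module**: opens `U_a`, finite index types `I_a` and frames
`e_a : 𝒪^{I_a} ≅ E|_{U_a}`. [folklore] -/
structure Framing where
  /-- The open `U_a`. -/
  U : ι → X.Opens
  /-- The index type of the frame over `U_a`. -/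
  I : ι → Type u
  /-- The index types are finite. -/
  [instFintype : ∀ a, Fintype (I a)]
  /-- The index types have decidable equality. -/
  [instDecidableEq : ∀ a, DecidableEq (I a)]
  /-- The frame `e_a : 𝒪^{I_a} ≅ E|_{U_a}`. -/
  e : ∀ a, SheafOfModules.free (I a) ≅ E.over (U a)

attribute [instance] Framing.instFintype Framing.instDecidableEq

variable {E ι}

namespace Framing

variable (𝔣 : Framing E ι)

/-! ### Transition matrices -/

/-- The transition matrix `T_{ab} = T(e_a, e_b)` over an open `V ≤ U_a ⊓ U_b`. [folklore] -/
def T (a b : ι) (V : X.Opens) (ha : V ≤ 𝔣.U a) (hb : V ≤ 𝔣.U b) : Matrix (𝔣.I a) (𝔣.I b) Γ(X, V) :=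
  transition (𝔣.e a) (𝔣.e b) (homOfLE ha) (homOfLE hb)

/-- `T_{ab}` is compatible with restriction. [folklore] -/
lemma T_map (a b : ι) {V V' : X.Opens} (ha : V ≤ 𝔣.U a) (hb : V ≤ 𝔣.U b) (h : V' ≤ V) :
    (𝔣.T a b V ha hb).map (secRes X h) = 𝔣.T a b V' (h.trans ha) (h.trans hb) :=
  transition_map (𝔣.e a) (𝔣.e b) (homOfLE ha) (homOfLE hb) (homOfLE h)

/-- `T_{ab} T_{bd} = T_{ad}`. [folklore] -/
lemma T_mul (a b d : ι) (V : X.Opens) (ha : V ≤ 𝔣.U a) (hb : V ≤ 𝔣.U b) (hd : V ≤ 𝔣.U d) :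
    𝔣.T a b V ha hb * 𝔣.T b d V hb hd = 𝔣.T a d V ha hd :=
  transition_mul _ _ _ _ _ _

/-- `T_{aa} = 1`. [folklore] -/
lemma T_self (a : ι) (V : X.Opens) (ha : V ≤ 𝔣.U a) : 𝔣.T a a V ha ha = 1 :=
  transition_self _ _

/-- `T_{ab} T_{ba} = 1`. [folklore] -/
lemma T_mul_symm (a b : ι) (V : X.Opens) (ha : V ≤ 𝔣.U a) (hb : V ≤ 𝔣.U b) :
    𝔣.T a b V ha hb * 𝔣.T b a V hb ha = 1 := by
  rw [T_mul, T_self]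

/-! ### The local endomorphism of a matrix between two frames -/

/-- **`op a z V A : E|_V → E|_V`**, the endomorphism attached to a matrix `A ∈ M_{I_a × I_z}(Γ(X, V))`
"from the frame `e_z` to the frame `e_a`": in the frame `e_a` it has matrix `A · T_{za}` (so that
its value on a section with `e_z`-coordinates `λ` has `e_a`-coordinates `A λ`). [folklore] -/
def op (a z : ι) (V : X.Opens) (ha : V ≤ 𝔣.U a) (hz : V ≤ 𝔣.U z) (A : Matrix (𝔣.I a) (𝔣.I z) Γ(X, V)) :
    E.over V ⟶ E.over V :=
  matrixEnd (𝔣.e a) (homOfLE ha) (A * 𝔣.T z a V hz ha)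

/-- `op` is additive. [folklore] -/
lemma op_add (a z : ι) (V : X.Opens) (ha : V ≤ 𝔣.U a) (hz : V ≤ 𝔣.U z)
    (A B : Matrix (𝔣.I a) (𝔣.I z) Γ(X, V)) :
    𝔣.op a z V ha hz (A + B) = 𝔣.op a z V ha hz A + 𝔣.op a z V ha hz B := by
  rw [op, op, op, Matrix.add_mul, matrixEnd_add]

/-- `op` is compatible with subtraction. [folklore] -/
lemma op_sub (a z : ι) (V : X.Opens) (ha : V ≤ 𝔣.U a) (hz : V ≤ 𝔣.U z)
    (A B : Matrix (𝔣.I a) (𝔣.I z) Γ(X, V)) :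
    𝔣.op a z V ha hz (A - B) = 𝔣.op a z V ha hz A - 𝔣.op a z V ha hz B := by
  rw [op, op, op, Matrix.sub_mul, matrixEnd_sub]

/-- `op 0 = 0`. [folklore] -/
lemma op_zero (a z : ι) (V : X.Opens) (ha : V ≤ 𝔣.U a) (hz : V ≤ 𝔣.U z) :
    𝔣.op a z V ha hz 0 = 0 := by
  rw [op, Matrix.zero_mul, matrixEnd_zero]

/-- `op` as an additive map. [folklore] -/
def opHom (a z : ι) (V : X.Opens) (ha : V ≤ 𝔣.U a) (hz : V ≤ 𝔣.U z) :
    Matrix (𝔣.I a) (𝔣.I z) Γ(X, V) →+ (E.over V ⟶ E.over V) where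
  toFun := 𝔣.op a z V ha hz
  map_zero' := 𝔣.op_zero a z V ha hz
  map_add' := 𝔣.op_add a z V ha hz

/-- Unfolding `opHom`. [folklore] -/
@[simp] lemma opHom_apply (a z : ι) (V : X.Opens) (ha : V ≤ 𝔣.U a) (hz : V ≤ 𝔣.U z)
    (A : Matrix (𝔣.I a) (𝔣.I z) Γ(X, V)) : 𝔣.opHom a z V ha hz A = 𝔣.op a z V ha hz A := rfl

/-- **`op` is injective**: the matrix is determined by the endomorphism. [folklore] -/
theorem op_injective (a z : ι) (V : X.Opens) (ha : V ≤ 𝔣.U a) (hz : V ≤ 𝔣.U z) :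
    Function.Injective (𝔣.op a z V ha hz) := by
  intro A B h
  have h' := matrixEnd_injective (𝔣.e a) (homOfLE ha) h
  have h'' := congrArg (fun M => M * 𝔣.T a z V ha hz) h'
  simp only [Matrix.mul_assoc, T_mul_symm, Matrix.mul_one] at h''
  exact h''

/-- **Restriction**: `(op_V A)|_{V'} = op_{V'} (A|_{V'})`. [folklore] -/
theorem restrictHom_op (a z : ι) {V V' : X.Opens} (ha : V ≤ 𝔣.U a) (hz : V ≤ 𝔣.U z) (l : V' ⟶ V)
    (A : Matrix (𝔣.I a) (𝔣.I z) Γ(X, V)) :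
    restrictHom l (𝔣.op a z V ha hz A) =
      𝔣.op a z V' (l.le.trans ha) (l.le.trans hz) (A.map (secRes X l.le)) := by
  rw [op, op, restrictHom_matrixEnd, Matrix.map_mul]
  change matrixEnd (𝔣.e a) _ (A.map (secRes X l.le) * (𝔣.T z a V hz ha).map (secRes X l.le)) = _
  rw [T_map]
  exact congrArg (fun k => matrixEnd (𝔣.e a) k _) (Subsingleton.elim _ _)

/-- **Change of the first frame**: `op b z A = op a z (T_{ab} A)`. [cite: Hartshorne1977, II.5 (p. 109)] -/
theorem op_eq_op_of_frame (a b z : ι) (V : X.Opens) (ha : V ≤ 𝔣.U a) (hb : V ≤ 𝔣.U b) (hz : V ≤ 𝔣.U z)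
    (A : Matrix (𝔣.I b) (𝔣.I z) Γ(X, V)) :
    𝔣.op b z V hb hz A = 𝔣.op a z V ha hz (𝔣.T a b V ha hb * A) := by
  rw [op, op, matrixEnd_changeFrame (𝔣.e a) (𝔣.e b) (homOfLE ha) (homOfLE hb)]
  change matrixEnd (𝔣.e a) _ (𝔣.T a b V ha hb * (A * 𝔣.T z b V hz hb) * 𝔣.T b a V hb ha) = _
  simp only [Matrix.mul_assoc, T_mul]

/-- **Change of the second frame**: `op a b B = op a z (B T_{bz})`. [folklore] -/
theorem op_eq_op_of_target (a b z : ι) (V : X.Opens) (ha : V ≤ 𝔣.U a) (hb : V ≤ 𝔣.U b) (hz : V ≤ 𝔣.U z)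
    (B : Matrix (𝔣.I a) (𝔣.I b) Γ(X, V)) :
    𝔣.op a b V ha hb B = 𝔣.op a z V ha hz (B * 𝔣.T b z V hb hz) := by
  rw [op, op, Matrix.mul_assoc, T_mul]

/-- **Values of `op` restrict**: `(op_V A · t)|_{V'} = op_{V'}(A|_{V'}) · (t|_{V'})`. [folklore] -/
theorem res_appLE_op (a z : ι) {V V' : X.Opens} (ha : V ≤ 𝔣.U a) (hz : V ≤ 𝔣.U z) (l : V' ≤ V)
    (A : Matrix (𝔣.I a) (𝔣.I z) Γ(X, V)) (t : Γ(E, V)) :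
    E.presheaf.map (homOfLE l).op (appLE (𝔣.op a z V ha hz A) (𝟙 V) t) =
      appLE (𝔣.op a z V' (l.trans ha) (l.trans hz) (A.map (secRes X l))) (𝟙 V')
        (E.presheaf.map (homOfLE l).op t) := by
  rw [← appLE_map, Category.comp_id, ← Category.id_comp (homOfLE l), ← appLE_restrictHom,
    restrictHom_op]

/-! ### Matrix cochains and the morphisms `E → Čⁿ(𝓤, E)` -/

/-- **A matrix `n`-cochain of `𝓔nd(E)` in the framing**: for each simplex `α = (α₀, …, αₙ)` and each
open `V` below all `U_{α_k}`, a matrix `X_α ∈ M_{I_{α₀} × I_{αₙ}}(Γ(X, V))` (from the frame at the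
last vertex to the frame at the first), compatible with restriction. [folklore] -/
structure Cochain (n : ℕ) where
  /-- The matrix `X_α` over `V`. -/
  mat : ∀ (α : Fin (n + 1) → ι) (V : X.Opens), (∀ k, V ≤ 𝔣.U (α k)) →
    Matrix (𝔣.I (α 0)) (𝔣.I (α (Fin.last n))) Γ(X, V)
  /-- Compatibility with restriction. -/
  map_mat : ∀ (α : Fin (n + 1) → ι) {V V' : X.Opens} (hV : ∀ k, V ≤ 𝔣.U (α k)) (h : V' ≤ V),
    (mat α V hV).map (secRes X h) = mat α V' fun k => h.trans (hV k)

namespace Cochain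

variable {𝔣} {n : ℕ}

/-- Matrix cochains are equal when their matrices are. [folklore] -/
@[ext] lemma ext {c c' : 𝔣.Cochain n} (h : ∀ α V hV, c.mat α V hV = c'.mat α V hV) : c = c' := by
  cases c; cases c'; congr; funext α V hV; exact h α V hV

/-- The zero cochain. [folklore] -/
instance : Zero (𝔣.Cochain n) where
  zero :=
    { mat := fun _ _ _ => 0
      map_mat := fun _ _ _ _ _ => by rw [Matrix.map_zero _ (map_zero _)] }

/-- Sum of cochains. [folklore] -/
instance : Add (𝔣.Cochain n) where
  add c c' :=
    { mat := fun α V hV => c.mat α V hV + c'.mat α V hV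
      map_mat := fun α _ _ hV h => by rw [Matrix.map_add _ (map_add _), c.map_mat, c'.map_mat] }

/-- Negation of cochains. [folklore] -/
instance : Neg (𝔣.Cochain n) where
  neg c :=
    { mat := fun α V hV => -c.mat α V hV
      map_mat := fun α _ _ hV h => by rw [Matrix.map_neg _ (map_neg _), c.map_mat] }

/-- Difference of cochains. [folklore] -/
instance : Sub (𝔣.Cochain n) where
  sub c c' :=
    { mat := fun α V hV => c.mat α V hV - c'.mat α V hV
      map_mat := fun α _ _ hV h => by rw [Matrix.map_sub _ (map_sub _), c.map_mat, c'.map_mat] }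

/-- Matrices of the zero cochain. [folklore] -/
@[simp] lemma zero_mat (α V hV) : (0 : 𝔣.Cochain n).mat α V hV = 0 := rfl

/-- Matrices of a sum. [folklore] -/
@[simp] lemma add_mat (c c' : 𝔣.Cochain n) (α V hV) :
    (c + c').mat α V hV = c.mat α V hV + c'.mat α V hV := rfl

/-- Matrices of a negation. [folklore] -/
@[simp] lemma neg_mat (c : 𝔣.Cochain n) (α V hV) : (-c).mat α V hV = -c.mat α V hV := rfl

/-- Matrices of a difference. [folklore] -/
@[simp] lemma sub_mat (c c' : 𝔣.Cochain n) (α V hV) :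
    (c - c').mat α V hV = c.mat α V hV - c'.mat α V hV := rfl

end Cochain

/-- `V ⊓ U_α ≤ U_{α_k}`. [folklore] -/
lemma inf_face_le (V : X.Opens) {n : ℕ} (α : Fin (n + 1) → ι) (k : Fin (n + 1)) :
    V ⊓ face 𝔣.U α ≤ 𝔣.U (α k) :=
  inf_le_right.trans (face_le 𝔣.U α k)

/-- The local operator of a cochain on the simplex `α` over `V ⊓ U_α`. [folklore] -/
def locOp {n : ℕ} (c : 𝔣.Cochain n) (V : X.Opens) (α : Fin (n + 1) → ι) :
    E.over (V ⊓ face 𝔣.U α) ⟶ E.over (V ⊓ face 𝔣.U α) :=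
  𝔣.op (α 0) (α (Fin.last n)) (V ⊓ face 𝔣.U α) (𝔣.inf_face_le V α 0) (𝔣.inf_face_le V α (Fin.last n))
    (c.mat α (V ⊓ face 𝔣.U α) (𝔣.inf_face_le V α))

/-- Restricting the local operators of a cochain. [folklore] -/
lemma restrictHom_locOp {n : ℕ} (c : 𝔣.Cochain n) {V W : X.Opens} (α : Fin (n + 1) → ι)
    (l : W ⊓ face 𝔣.U α ⟶ V ⊓ face 𝔣.U α) :
    restrictHom l (𝔣.locOp c V α) = 𝔣.locOp c W α := by
  rw [locOp, locOp, restrictHom_op, c.map_mat]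

/-- **The morphism `E ⟶ Čⁿ(𝓤, E)` of a matrix `n`-cochain**: `s ↦ (op_{α₀αₙ}(X_α)(s|_{V ∩ U_α}))_α`.
[cite: Hartshorne1977, III.4] -/
def toEnd (n : ℕ) (c : 𝔣.Cochain n) : E ⟶ Cech.obj 𝔣.U n E :=
  Cech.homMk
    (fun V s α => appLE (𝔣.locOp c V α) (𝟙 _) (E.presheaf.map (homOfLE inf_le_left).op s))
    (fun V s t => funext fun α => by rw [map_add, appLE_add_right]; rfl)
    (fun V r s => funext fun α => by
      rw [Scheme.Modules.map_smul, appLE_smul_right]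
      rfl)
    (fun V W i s => funext fun α => by
      rw [Cech.restrict_apply, presheaf_map_map]
      change _ = E.presheaf.map (homOfLE (inf_le_inf_right (face 𝔣.U α) i.le)).op
        (appLE (𝔣.locOp c V α) (𝟙 _) (E.presheaf.map (homOfLE inf_le_left).op s))
      rw [← appLE_map, Category.comp_id, presheaf_map_map,
        ← Category.id_comp (homOfLE (inf_le_inf_right (face 𝔣.U α) i.le)), ← appLE_restrictHom,
        restrictHom_locOp]
      rfl)

/-- **Components of `toEnd`.** [folklore] -/
@[simp]
lemma toEnd_app {n : ℕ} (c : 𝔣.Cochain n) (V : X.Opens) (s : Γ(E, V)) (α : Fin (n + 1) → ι) :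
    ((𝔣.toEnd n c).app V s : Cech.Sections 𝔣.U n E V) α =
      appLE (𝔣.locOp c V α) (𝟙 _) (E.presheaf.map (homOfLE inf_le_left).op s) :=
  rfl

/-- `toEnd` is additive. [folklore] -/
theorem toEnd_add {n : ℕ} (c c' : 𝔣.Cochain n) : 𝔣.toEnd n (c + c') = 𝔣.toEnd n c + 𝔣.toEnd n c' :=
  Cech.hom_ext_to fun V s α => by
    rw [Cech.add_app_apply, toEnd_app, toEnd_app, toEnd_app, locOp, Cochain.add_mat, op_add, appLE_add]
    rfl

/-- `toEnd` is compatible with subtraction. [folklore] -/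
theorem toEnd_sub {n : ℕ} (c c' : 𝔣.Cochain n) : 𝔣.toEnd n (c - c') = 𝔣.toEnd n c - 𝔣.toEnd n c' :=
  Cech.hom_ext_to fun V s α => by
    rw [← Cech.evalAt_apply V s α (𝔣.toEnd n c - 𝔣.toEnd n c'), map_sub, Cech.evalAt_apply,
      Cech.evalAt_apply, toEnd_app, toEnd_app, toEnd_app, locOp, locOp, locOp, Cochain.sub_mat, op_sub]
    exact map_sub (appLEHom (𝟙 _) _) _ _

end Framing

end Literature.AlgebraicGeometry.Modules

end
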